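import Summits.ResolutionOfSingularities.ResolutionOfSingularities.Theses.UniformComplexity
import Summits.ResolutionOfSingularities.ResolutionOfSingularities.Theorems.UniformComplexityPrimeModelTransferSpecialization
import Summits.ResolutionOfSingularities.ResolutionOfSingularities.Theorems.UniformComplexityPrimeModelTransferAlgClosedTower
import Mathlib.FieldTheory.IsAlgClosed.AlgebraicClosure
import Mathlib.FieldTheory.IntermediateField.Adjoin.Algebra
import Mathlib.RingTheory.AlgebraicIndependent.TranscendenceBasis
import Mathlib.RingTheory.AlgebraicIndependent.Basic
import Mathlib.RingTheory.MvPolynomial.Basic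
import Mathlib.Algebra.CharP.Algebra
import HarnessLib

/-!
# Crux `PrimeModelTransfer` (stmt-ResolutionOfSingularities-8933), door 2 of slot W8.2:
# ONE FIELD SUFFICES — the crux is an implication between two countable fields

Route `ResolutionOfSingularities/UniformComplexity`. By the specialization theorem
(`PrimeModelTransfer.integralResOver_of_integralResOver_extension`, p484634) resolution passes DOWN
from a perfect field to any algebraically closed subfield. Since every algebraically closed field
of finite transcendence degree over `𝔽_p` EMBEDS into the algebraic closure
`Ω₀(p) := (𝔽_p(x₀, x₁, …))^{alg}` of the rational function field in countably many variables
(`nonempty_algHom_algebraicClosure_adjoin`: transcendence basis + `IsAlgClosed.lift`), and the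
crux only needs resolution over such subfields (descent `hasResolution_of_perfectSubfields`,
p470438), we get the model-theoretic normal form recorded in `DOOR2-KERNEL.md` §3(c):

* `primeModelTransfer_iff_oneField` — `UniformComplexity.PrimeModelTransfer` holds iff for every
  prime `p`, resolution over the algebraically closed fields algebraic over `𝔽_p` (the crux
  hypothesis) implies resolution of all integral separated schemes of finite type over the ONE
  field `AlgebraicClosure (FractionRing (MvPolynomial ℕ (ZMod p)))`.

So door 2 is ONE implication «`Res(𝔽̄_p) ⇒ Res(Ω₀(p))`» between two countable algebraically
closed fields (the prime model and the countable saturated model of `ACF_p`).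

[OURS · LADDER-RESOLUTION L1, slot W8.2 (prime-field / universality transfer), door 2
UniformComplexity] Theorems over the summit's own route; NOT statements of, and attributing
nothing to, Hironaka's 2017 manuscript. AI-written; weaker than expert review. No resolution is
base-changed along any inseparable extension (only the specialization theorem is used).
-/

noncomputable section

set_option linter.dupNamespace false -- mandated namespace of this single-conjunct summit

open CategoryTheory CategoryTheory.Limits AlgebraicGeometry TopologicalSpace
open Literature.AlgebraicGeometry.Resolution
open Summit.ResolutionOfSingularities.ResolutionOfSingularities.Theses.UniformComplexity (PrimeModelTransfer)
open scoped IntermediateField.algebraAdjoinAdjoin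

namespace Summit.ResolutionOfSingularities.ResolutionOfSingularities.Theorems.PrimeModelTransfer

/-! ## Embedding fields of finite transcendence degree -/

/-- **Algebraically closed targets of infinite transcendence degree receive every field of finite
type-up-to-algebraic-extension.** Let `F ⊆ K` be fields, `s ⊆ K` finite, and `A` the algebraic
closure in `K` of `F(s)`. If `Ω ⊇ F` is algebraically closed and contains a sequence
`x : ℕ → Ω` algebraically independent over `F`, then there is a ring map `A → Ω`: choose
a transcendence basis `t ⊆ s` of `F[s]` over `F`, send it injectively into the `xᵢ`
(`F[t] ≅ F[Xᵢ : i ∈ t] ↪ Ω`), and extend to `A`, which is algebraic over `F[t]`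
(`IsAlgClosed.lift`). [folklore] -/
theorem nonempty_algHom_algebraicClosure_adjoin (F : Type) [Field F] (K : Type) [Field K]
    [Algebra F K] (s : Finset K) (Ω : Type) [Field Ω] [Algebra F Ω] [IsAlgClosed Ω] (x : ℕ → Ω)
    (hx : AlgebraicIndependent F x) :
    Nonempty (algebraicClosure (IntermediateField.adjoin F (↑s : Set K)) K →+* Ω) := by
  classical
  -- the domain `D = F[s]`, the field `E = F(s)` and `A = E^{alg} ∩ K`
  let D : Subalgebra F K := Algebra.adjoin F (↑s : Set K)
  let E : IntermediateField F K := IntermediateField.adjoin F (↑s : Set K)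
  let A : IntermediateField E K := algebraicClosure E K
  -- `D` is generated by the (finite) preimage of `s`
  let sD : Set D := Subtype.val ⁻¹' (↑s : Set K)
  have hsD_fin : sD.Finite := (s.finite_toSet.preimage Subtype.val_injective.injOn)
  have hsD : Algebra.adjoin F sD = ⊤ := by
    apply Subalgebra.map_injective (f := D.val) Subtype.val_injective
    rw [AlgHom.map_adjoin, Algebra.map_top, Subalgebra.range_val]
    have himg : (D.val : D → K) '' sD = (↑s : Set K) := by
      ext y
      constructor
      · rintro ⟨z, hz, rfl⟩; exact hz
      · intro hy; exact ⟨⟨y, Algebra.subset_adjoin hy⟩, hy, rfl⟩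
    change Algebra.adjoin F (D.val '' sD) = D
    rw [himg]
  haveI : Algebra.IsAlgebraic (Algebra.adjoin F sD) D :=
    ⟨fun d => by
      have hd : d ∈ Algebra.adjoin F sD := hsD ▸ Algebra.mem_top
      exact isAlgebraic_algebraMap (R := Algebra.adjoin F sD) (A := D) ⟨d, hd⟩⟩
  -- a finite transcendence basis `t ⊆ sD` of `D` over `F`
  obtain ⟨t, hts, ht⟩ := exists_isTranscendenceBasis_subset (R := F) (A := D) sD
  haveI : Finite t := (hsD_fin.subset hts).to_subtype
  obtain ⟨e, he⟩ := Countable.exists_injective_nat t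
  -- the polynomial ring `R₁ = F[T_i : i ∈ t]`, acting on `D` through `t` and on `Ω` through `x ∘ e`
  let R₁ : Type := MvPolynomial t F
  letI : Algebra R₁ D := (MvPolynomial.aeval (Subtype.val : t → D)).toRingHom.toAlgebra
  have hR₁D : Function.Injective (algebraMap R₁ D) := algebraicIndependent_iff_injective_aeval.mp ht.1
  haveI : Algebra.IsAlgebraic R₁ D := by
    haveI := ht.isAlgebraic
    refine Algebra.IsAlgebraic.of_ringHom_of_comp_eq
      (S := Algebra.adjoin F (Set.range (Subtype.val : t → D))) (B := D)
      (ht.1.aevalEquiv : R₁ →ₐ[F] _).toRingHom (RingHom.id D) ht.1.aevalEquiv.surjective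
      Function.injective_id ?_
    exact RingHom.ext fun q => ht.1.algebraMap_aevalEquiv q
  have hx' : AlgebraicIndependent F (x ∘ e) := hx.comp e he
  letI algΩ : Algebra R₁ Ω := (MvPolynomial.aeval (x ∘ e)).toRingHom.toAlgebra
  have hR₁Ω : Function.Injective (algebraMap R₁ Ω) :=
    algebraicIndependent_iff_injective_aeval.mp hx'
  -- `A` is algebraic over `R₁` (through `D ⊆ E ⊆ A`)
  letI : Algebra D A := ((algebraMap E A).comp (algebraMap D E)).toAlgebra
  haveI : IsScalarTower D E A := IsScalarTower.of_algebraMap_eq fun _ => rfl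
  haveI : Algebra.IsAlgebraic E A := algebraicClosure.isAlgebraic E K
  haveI : Algebra.IsAlgebraic D A := Algebra.IsAlgebraic.trans D E A
  have hDA : Function.Injective (algebraMap D A) :=
    (algebraMap E A).injective.comp (FaithfulSMul.algebraMap_injective D E)
  letI : Algebra R₁ A := ((algebraMap D A).comp (algebraMap R₁ D)).toAlgebra
  haveI : IsScalarTower R₁ D A := IsScalarTower.of_algebraMap_eq fun _ => rfl
  haveI : Algebra.IsAlgebraic R₁ A := Algebra.IsAlgebraic.trans R₁ D A
  haveI : FaithfulSMul R₁ A :=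
    (faithfulSMul_iff_algebraMap_injective R₁ A).mpr (hDA.comp hR₁D)
  haveI : FaithfulSMul R₁ Ω := (faithfulSMul_iff_algebraMap_injective R₁ Ω).mpr hR₁Ω
  haveI : Module.IsTorsionFree R₁ A := FaithfulSMul.to_isTorsionFree R₁ A
  haveI : Module.IsTorsionFree R₁ Ω := FaithfulSMul.to_isTorsionFree R₁ Ω
  -- lift
  let ψ : A →ₐ[R₁] Ω := IsAlgClosed.lift
  exact ⟨ψ.toRingHom⟩

/-! ## The one-field normal form -/

/-- `(𝔽_p(x₀, x₁, …))^{alg}` contains an algebraically independent sequence over `𝔽_p` (the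
variables). [folklore] -/
theorem algebraicIndependent_X_algebraicClosure (p : ℕ) [Fact p.Prime] :
    AlgebraicIndependent (ZMod p) (fun i : ℕ =>
      algebraMap (MvPolynomial ℕ (ZMod p)) (AlgebraicClosure (FractionRing (MvPolynomial ℕ (ZMod p))))
        (MvPolynomial.X i)) := by
  have h := (MvPolynomial.algebraicIndependent_X ℕ (ZMod p)).map'
    (f := IsScalarTower.toAlgHom (ZMod p) (MvPolynomial ℕ (ZMod p))
      (AlgebraicClosure (FractionRing (MvPolynomial ℕ (ZMod p)))))
    ((algebraMap (FractionRing (MvPolynomial ℕ (ZMod p))) _).injective.comp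
      (IsFractionRing.injective (MvPolynomial ℕ (ZMod p)) (FractionRing (MvPolynomial ℕ (ZMod p)))))
  exact h

/-- **Normal form 3: one field suffices.** `UniformComplexity.PrimeModelTransfer` holds iff for
every prime `p` the crux hypothesis (resolution over the algebraically closed fields of
characteristic `p` algebraic over `𝔽_p`) implies resolution of all integral separated schemes of
finite type over the single countable algebraically closed field
`Ω₀(p) = AlgebraicClosure (FractionRing (MvPolynomial ℕ (ZMod p)))`. (⇒: `Ω₀(p)` is
algebraically closed of characteristic `p`. ⇐: for `K` algebraically closed of characteristic `p`
it suffices to resolve over the algebraically closed subfields `(𝔽_p(s))^{alg} ∩ K`, `s` finite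
(`hasResolution_of_perfectSubfields`); each embeds into `Ω₀(p)`
(`nonempty_algHom_algebraicClosure_adjoin`), so resolution over it follows from resolution over
`Ω₀(p)` by specialization (`integralResOver_of_integralResOver_extension`).) [folklore] -/
theorem primeModelTransfer_iff_oneField :
    PrimeModelTransfer ↔ ∀ (p : ℕ) [Fact p.Prime],
      (∀ (k : Type) [Field k] [CharP k p] [IsAlgClosed k],
        (∀ x : k, ∃ n : ℕ, 0 < n ∧ x ^ p ^ n = x) →
        ∀ (X : Scheme.{0}) (f : X ⟶ Spec (.of k)), IsSeparated f → LocallyOfFiniteType f →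
          QuasiCompact f → IsIntegral X → Scheme.HasResolution X) →
      ∀ (X : Scheme.{0})
        (f : X ⟶ Spec (.of (AlgebraicClosure (FractionRing (MvPolynomial ℕ (ZMod p)))))),
        IsSeparated f → LocallyOfFiniteType f → QuasiCompact f → IsIntegral X →
          Scheme.HasResolution X := by
  constructor
  · intro h p hp hA X f hs hl hq hX
    exact h p hp.out hA (AlgebraicClosure (FractionRing (MvPolynomial ℕ (ZMod p)))) X f hs hl hq hX
  · intro h p hp hA K _ _ _ X f hs hl hq hX
    haveI : Fact p.Prime := ⟨hp⟩
    classical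
    let Ω : Type := AlgebraicClosure (FractionRing (MvPolynomial ℕ (ZMod p)))
    have hΩ : ∀ (Y : Scheme.{0}) (g : Y ⟶ Spec (.of Ω)), IsSeparated g → LocallyOfFiniteType g →
        QuasiCompact g → IsIntegral Y → Scheme.HasResolution Y := h p hA
    haveI : PerfectField Ω := IsAlgClosed.perfectField Ω
    haveI : PerfectField K := IsAlgClosed.perfectField K
    letI : Algebra (ZMod p) K := ZMod.algebra K p
    refine hasResolution_of_perfectSubfields K (fun s => ?_) X f hs hl hq hX
    let E : IntermediateField (ZMod p) K := IntermediateField.adjoin (ZMod p) (↑s : Set K)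
    let A : IntermediateField E K := algebraicClosure E K
    haveI : IsAlgClosed A := IsAlgClosure.isAlgClosed E
    refine ⟨A.toSubfield, fun y hy => ?_, inferInstanceAs (PerfectField A), ?_⟩
    · exact A.algebraMap_mem (⟨y, IntermediateField.subset_adjoin _ _ hy⟩ : E)
    · -- `A` embeds into `Ω`; specialise
      obtain ⟨ψ⟩ := nonempty_algHom_algebraicClosure_adjoin (ZMod p) K s Ω _
        (algebraicIndependent_X_algebraicClosure p)
      letI : Algebra A Ω := ψ.toAlgebra
      exact fun Y g hs' hl' hq' hY =>
        integralResOver_of_integralResOver_extension A Ω hΩ Y g hs' hl' hq' hY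

end Summit.ResolutionOfSingularities.ResolutionOfSingularities.Theorems.PrimeModelTransfer

end
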